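import Summits.HodgeConjecture.HodgeConjecture.Theorems.F0P3cStCharTSExpAsymp   -- ★ p848343 «EXP-ASYMP» (this seat): fibre sums from one-sided asymptotics
import Mathlib.LinearAlgebra.LinearIndependent.Lemmas                          -- Mathlib ★ `linearIndependent_monoidHom` (Dedekind–Artin)
import HarnessLib

/-!
# F0 · P3c · line LH6 «StCharTS» — brick «ARTIN-ASYMP» of organ (S-a): DISTINCT CHARACTERS OF A TORUS ARE ASYMPTOTICALLY INDEPENDENT ON A DOMINANT RAY —
# `Σ_i c_i θ_i(u·aᵐ) = o(Rᵐ)` (`m → +∞`, every `u ∈ T₀`) forces `c_i = 0` for every `θ_i` with `‖θ_i(a)‖ ≥ R`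

Cell `pub/hodgecm-mathlib`, crux H413 = `stmt-HodgeConjecture-24833` (lane `--supports … --as helper`), route HCCMUnconditional; seat LH6-p05 (g0); organ (S-a)
`stub_StSupportFiniteSqInt` of the LH6 pay-down skeleton (v2 3bd6ede806aaa044 :158) on the «shell» road.  THEOREMS ONLY, sorry-free; imports ★ «EXP-ASYMP»
(p848343) + Mathlib's Artin theorem.  This is the DECAY twin of LH6-p02's ★ «ARTIN-S» (`F0P3cStCharTSArtinRay`, exact vanishing on the ray ⇒ `c = 0`).
HONEST LABEL: HC_CM is proved only modulo the printed citations (2 remaining named inputs hLiu418 24832, h413 24833) until rung 0 closes; count-neutral algebra.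

THE MATHEMATICS.  [Rogawski1990, §12.7 proof of Lemma 12.7.2, pp. 192–194] separates the members of the (β)-datum by the growth of their characters on the
split torus `M` far from the walls: after Casselman, on the dominant shells `u·aᵐ` (`u` in the compact part `T₀`, `a` the ray generator) every member contributes
`Σ_j c_j θ_j(u·aᵐ)` for finitely many exponent characters `θ_j` of `M`; square-integrable members (and the `H`-side `St_H(ξ)`) have `‖θ_j(a)‖ < 1` in the
`D`-normalisation, a unitary principal-series member has an exponent with `‖θ(a)‖ ≥ 1`; print concludes with «`|Σ z_j^n|` cannot converge to zero» (p. 194) after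
isolating an `𝒪_E^*`-type `χ₀` (p. 193).  Here: if the total sum is `o(Rᵐ)` along the ray for every `u ∈ T₀`, then (★ «EXP-ASYMP», fibre form, in the variable
`m` for each fixed `u`) the sum `Σ_{θ_i(a) = w} c_i θ_i(u)` vanishes for every `‖w‖ ≥ R` and every `u ∈ T₀`, and (Artin on `T₀`: inside a fibre the restrictions
`θ_i|T₀` are pairwise distinct) each such `c_i` vanishes — no distinctness of the values `θ_i(a)` across members is needed, only distinctness of the characters on
`⟨T₀, a⟩`, exactly ★ «ARTIN-S»'s hypothesis.

* `eq_zero_of_fiber_relation_on_compact_part` — Artin inside a fibre `{θ_i(a) = w}`: `Σ_{θ_i(a) = w} d_i θ_i(u) = 0` for all `u ∈ T₀` ⇒ `d_i = 0` on the fibre.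
* `eq_zero_of_tendsto_sum_mul_char_on_ray` — «ARTIN-ASYMP»: `o(Rᵐ)` decay on the ray for every `u ∈ T₀` ⇒ `c_i = 0` whenever `R ≤ ‖θ_i(a)‖`.
* `eq_zero_of_tendsto_sum_mul_char_on_ray_one` — the case `R = 1` (plain decay ⇒ the coefficients of all NON-DECAYING exponents vanish).

## References
* [Rogawski1990] J. D. Rogawski, *Automorphic Representations of Unitary Groups in Three Variables*, Ann. of Math. Stud. 123 (1990), §12.7 proof of Lemma 12.7.2
  pp. 192–194; proof of Lemma 12.7.3 p. 195 («linear independence of characters»).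
* [Lang2002] S. Lang, *Algebra*, 3rd ed. (2002), VI §4 Thm. 4.1 (Artin: independence of characters).
-/

set_option autoImplicit false
-- the mandated namespace has the single-problem summit's repeated segment (`HodgeConjecture.HodgeConjecture`)
set_option linter.dupNamespace false

noncomputable section

open Filter Topology
open scoped BigOperators

namespace Summit.HodgeConjecture.HodgeConjecture.Cruxes.H413.F0P3cStCharTSArtinAsymp

open Summit.HodgeConjecture.HodgeConjecture.Cruxes.H413.F0P3cStCharTSExpAsymp

variable {T : Type*} [Group T] {ι : Type*} [Fintype ι]

/-- **Artin inside a fibre.**  Let `θ_i : T →* ℂˣ` be pairwise distinct on `⟨T₀, a⟩` (equal restrictions to `T₀` and equal values at `a` force `i = j`).  For a value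
`w`, the restrictions `θ_i|T₀` of the members of the fibre `{i | θ_i(a) = w}` are pairwise distinct, so a relation `Σ_{θ_i(a) = w} d_i θ_i(u) = 0` for all `u ∈ T₀`
forces `d_i = 0` on the fibre (Dedekind–Artin, Mathlib ★ `linearIndependent_monoidHom`). [cite: Lang2002, VI §4 Thm. 4.1] [cite: Rogawski1990, §12.7 proof of Lemma 12.7.3 p. 195] -/
theorem eq_zero_of_fiber_relation_on_compact_part (T₀ : Subgroup T) (a : T) (θ : ι → (T →* ℂˣ))
    (hθ : ∀ i j, (∀ u ∈ T₀, θ i u = θ j u) → θ i a = θ j a → i = j)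
    (d : ι → ℂ) (w : ℂ)
    (h : ∀ u ∈ T₀, ∑ i ∈ Finset.univ.filter (fun i => ((θ i a : ℂˣ) : ℂ) = w), d i * ((θ i u : ℂˣ) : ℂ) = 0) :
    ∀ i, ((θ i a : ℂˣ) : ℂ) = w → d i = 0 := by
  classical
  set F : Finset ι := Finset.univ.filter (fun i => ((θ i a : ℂˣ) : ℂ) = w) with hF
  -- the restrictions to `T₀`, read in `ℂ`
  let ρ : ι → (↥T₀ →* ℂ) := fun i => (Units.coeHom ℂ).comp ((θ i).restrict T₀)
  have hρ : ∀ (i : ι) (u : ↥T₀), ρ i u = ((θ i (u : T) : ℂˣ) : ℂ) := fun _ _ => rfl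
  -- `ρ` is injective on the fibre
  have hinj : ∀ i ∈ F, ∀ j ∈ F, ρ i = ρ j → i = j := by
    intro i hi j hj hij
    have hi' := (Finset.mem_filter.1 hi).2
    have hj' := (Finset.mem_filter.1 hj).2
    refine hθ i j (fun u hu => ?_) (Units.ext (hi'.trans hj'.symm))
    have e := DFunLike.congr_fun hij ⟨u, hu⟩
    rw [hρ, hρ] at e
    exact Units.ext e
  -- Artin: the functions `⇑(ρ i)`, `i ∈ F`, are linearly independent
  have hli : LinearIndependent ℂ (fun i : F => (⇑(ρ i.1) : ↥T₀ → ℂ)) :=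
    (linearIndependent_monoidHom (↥T₀) ℂ).comp (fun i : F => ρ i.1)
      (fun i j hij => Subtype.ext (hinj i.1 i.2 j.1 j.2 hij))
  -- the relation on `T₀`
  have hrel : ∑ i : F, d i.1 • (⇑(ρ i.1) : ↥T₀ → ℂ) = 0 := by
    funext u
    rw [Finset.sum_apply, Pi.zero_apply]
    have step : ∀ i : F, (d i.1 • (⇑(ρ i.1) : ↥T₀ → ℂ)) u = d i.1 * ((θ i.1 (u : T) : ℂˣ) : ℂ) := fun i => by
      rw [Pi.smul_apply, smul_eq_mul, hρ]
    simp only [step]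
    rw [Finset.sum_coe_sort F (fun i => d i * ((θ i (u : T) : ℂˣ) : ℂ))]
    exact h u u.2
  have hzero := Fintype.linearIndependent_iff.1 hli (fun i : F => d i.1) hrel
  intro i hi
  exact hzero ⟨i, Finset.mem_filter.2 ⟨Finset.mem_univ i, hi⟩⟩

/-- **«ARTIN-ASYMP»: distinct characters are asymptotically independent on a dominant ray.**  Let `T₀ ≤ T`, `a ∈ T`, `θ_i : T →* ℂˣ` (finite index type) pairwise
distinct on `⟨T₀, a⟩`, `c_i ∈ ℂ`, `0 < R`.  If for every `u ∈ T₀` the ray sums decay at rate `Rᵐ`, `(Σ_i c_i θ_i(u·aᵐ))·R^{−m} → 0` as `m → +∞`, then `c_i = 0`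
for every `i` with `R ≤ ‖θ_i(a)‖` (★ «EXP-ASYMP» in `m` for each `u`, then Artin inside the fibre). [cite: Rogawski1990, §12.7 proof of Lemma 12.7.2 pp. 192–194]
[cite: Lang2002, VI §4 Thm. 4.1] -/
theorem eq_zero_of_tendsto_sum_mul_char_on_ray (T₀ : Subgroup T) (a : T) (θ : ι → (T →* ℂˣ))
    (hθ : ∀ i j, (∀ u ∈ T₀, θ i u = θ j u) → θ i a = θ j a → i = j)
    (c : ι → ℂ) {R : ℝ} (hR : 0 < R)
    (h : ∀ u ∈ T₀, Tendsto (fun m : ℕ => (∑ i, c i * ((θ i (u * a ^ m) : ℂˣ) : ℂ)) * ((R : ℂ)⁻¹) ^ m) atTop (𝓝 0)) :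
    ∀ i, R ≤ ‖((θ i a : ℂˣ) : ℂ)‖ → c i = 0 := by
  classical
  intro i₀ hi₀
  set w : ℂ := ((θ i₀ a : ℂˣ) : ℂ) with hw
  -- for each `u ∈ T₀`: the fibre sum over `{θ i a = w}` of `c i θ i u` vanishes
  have hfib : ∀ u ∈ T₀, ∑ i ∈ Finset.univ.filter (fun i => ((θ i a : ℂˣ) : ℂ) = w), c i * ((θ i u : ℂˣ) : ℂ) = 0 := by
    intro u hu
    have h' : Tendsto (fun m : ℕ => (∑ i ∈ Finset.univ, (c i * ((θ i u : ℂˣ) : ℂ)) * ((θ i a : ℂˣ) : ℂ) ^ m) * ((R : ℂ)⁻¹) ^ m)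
        atTop (𝓝 0) := by
      refine (h u hu).congr fun m => ?_
      congr 1
      refine Finset.sum_congr rfl fun i _ => ?_
      rw [map_mul, map_pow, Units.val_mul, Units.val_pow_eq_pow_val, mul_assoc]
    exact fiber_sum_eq_zero_of_tendsto_mul_inv_pow Finset.univ (fun i => ((θ i a : ℂˣ) : ℂ)) (fun i => c i * ((θ i u : ℂˣ) : ℂ)) hR h' w
      (by rw [hw]; exact hi₀)
  exact eq_zero_of_fiber_relation_on_compact_part T₀ a θ hθ c w hfib i₀ rfl

/-- **«ARTIN-ASYMP», `R = 1`.**  Plain decay of the ray sums, `Σ_i c_i θ_i(u·aᵐ) → 0` (`m → +∞`) for every `u ∈ T₀`, forces `c_i = 0` for every NON-DECAYING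
exponent, `1 ≤ ‖θ_i(a)‖`. [cite: Rogawski1990, §12.7 proof of Lemma 12.7.2 pp. 192–194] -/
theorem eq_zero_of_tendsto_sum_mul_char_on_ray_one (T₀ : Subgroup T) (a : T) (θ : ι → (T →* ℂˣ))
    (hθ : ∀ i j, (∀ u ∈ T₀, θ i u = θ j u) → θ i a = θ j a → i = j)
    (c : ι → ℂ)
    (h : ∀ u ∈ T₀, Tendsto (fun m : ℕ => ∑ i, c i * ((θ i (u * a ^ m) : ℂˣ) : ℂ)) atTop (𝓝 0)) :
    ∀ i, 1 ≤ ‖((θ i a : ℂˣ) : ℂ)‖ → c i = 0 := by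
  refine eq_zero_of_tendsto_sum_mul_char_on_ray T₀ a θ hθ c zero_lt_one fun u hu => ?_
  refine (h u hu).congr fun m => ?_
  simp only [Complex.ofReal_one, inv_one, one_pow, mul_one]

end Summit.HodgeConjecture.HodgeConjecture.Cruxes.H413.F0P3cStCharTSArtinAsymp

end
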